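import Summits.Schanuel.Schanuel.Theorems.DiophantineDichotomyKhovanskiiApproxTypeEvRareFieldThreeLayers
import HarnessLib

/-!
# Crux `KhovanskiiApproxTypeEv` (stmt-Schanuel-14972) — THE STRATEGIST'S TYPED SPLIT INTO THREE LEAF SUB-CRUXES

Route `DiophantineDichotomy` (sub-problem `Schanuel/Schanuel`); crux
`Summit.Schanuel.Schanuel.Theses.DiophantineDichotomy.KhovanskiiApproxTypeEv` (eventual-in-the-height
simultaneous approximation type `a < 1/(n−1)` at every free Khovanskii point `θ = (s, e^s)`, `n ≥ 2`).
Seat `planner-cstrat-stmt-Schanuel-14972-p1-0` (crux-strategist, wall-breaker on the exhausted chain),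
`Cruxes/KhovanskiiApproxTypeEv/STRATEGY-CENSUS.md`.

After two ideation rounds every line on the crux AS FILED is dead for one reason, kernel-certified in the
tree: the crux is the conjunction of THREE open statements of DIFFERENT nature
(`khovanskiiApproxTypeEv_iff_threeLayers`, p136816; the Lindemann–Weierstrass layer at rank 2 is a
THEOREM, `stub_evLW_two`, p123471), so every concluding skeleton must carry the two non-LW layers as
stubs, and those are catalogued open problems (`barriers_of_khovanskiiApproxTypeEv`, p125943:
`⟹ e ⊥ π ∧ πi ⊥ log 2 ∧ log 2 ⊥ log 3 ∧ 2 ≤ trdeg ℚ(log 2, log 3, 2πi)`).  The strategist's answer is the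
typed DECOMPOSITION of the crux into its three leaves, filed as route items by
`ledger route edit route-Schanuel-DiophantineDichotomy --split KhovanskiiApproxTypeEv --into … --glue-by
…khovanskiiApproxTypeEv_of_subs` once this file is accepted:

* `LWLayerRankThreeUp` — the NAIVE-currency Lindemann–Weierstrass layer at rank `n ≥ 3` (`s ∈ ℚ̄ⁿ`;
  transcendence degree KNOWN = n; open for a purely Diophantine/certificational reason: every
  (degree, absolute height)-priced certificate is capped at `(n+1)/(2n) > 1/(n−1)`,
  `…RareFieldCertificateGame.lean` p136514, while the `(d,h)`-currency form is a theorem at every rank,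
  `evLWDh` p137028);
* `NonLWLayerRankTwo` — free Khovanskii points of `ℂ²` with a transcendental coordinate (⊇ `e ⊥ π` with a
  measure, the flagship `EPiSimultaneousTypeEv`; ⊇ `log 2 ⊥ log 3`; ⊇ "no Lambert `W(1/k)` is Liouville",
  p128146; at the Nesterenko point `(π, iπ)` = a linear-in-`log H` simultaneous measure for `(π, e^π)`);
* `NonLWLayerRankThreeUp` — free Khovanskii points of rank `≥ 3` with a transcendental coordinate (⊇ two
  algebraically independent logarithms of algebraic numbers, p124970).

The three children are written out over Mathlib exactly as they are filed in the route file (the route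
file's import cone is Mathlib + the Statement), and `khovanskiiApproxTypeEv_of_subs` is the sorry-free
glue `LWLayerRankThreeUp → NonLWLayerRankTwo → NonLWLayerRankThreeUp → KhovanskiiApproxTypeEv`
(case split on the rank and on `s ∈ ℚ̄ⁿ`, through p136816).  The converse `subs_of_khovanskiiApproxTypeEv`
is recorded too: the split loses nothing (each leaf is implied by the crux), and no leaf is the crux
reworded (each drops a rank range or a point class that carries certified content of its own).
Nothing here closes or refutes stmt-Schanuel-14972.
-/

noncomputable section

-- `Summit.Schanuel.Schanuel.…` is the mandated summit/sub-problem namespace (single-conjunct summit), hence: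
set_option linter.dupNamespace false

namespace Summit.Schanuel.Schanuel.Cruxes.KhovanskiiApproxTypeEv.Split

open Summit.Schanuel.Schanuel.Theses.DiophantineDichotomy (KhovanskiiApproxTypeEv)
open Summit.Schanuel.Schanuel.Cruxes.KhovanskiiApproxType.LwSmallHeight (IsFreeKhovanskii)
open Summit.Schanuel.Schanuel.Cruxes.KhovanskiiApproxTypeEv.AnchoredReduction
  (ApproxTypeEvAt EvNonLWTwo khovanskiiApproxTypeEv_iff)
open Summit.Schanuel.Schanuel.Cruxes.KhovanskiiApproxTypeEv.RareFieldSpecies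
  (EvLW EvNonLWRankThreeUp khovanskiiApproxTypeEv_iff_threeLayers)

/-! ## The three leaves, VERBATIM as filed in the route file (Mathlib-only vocabulary) -/

/-- LEAF 1 `LWLayerRankThreeUp` — the naive-currency Lindemann–Weierstrass layer of the crux at rank
`n ≥ 3`: every `s ∈ ℚ̄ⁿ` (`n ≥ 3`) with `ℚ`-linearly independent coordinates (automatically a free
Khovanskii point, `LWPointFree` p136499) has eventual simultaneous approximation type `a < 1/(n−1)`:
`∃ a < 1/(n−1), b, C > 0, ∀ d ∃ H₀ ∀ H ≥ H₀ ∀ γ` of level `(d, H)`: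
`‖γ − (s, e^s)‖ ≥ exp(−C(dᵃ log H + dᵇ))`. -/
def LWLayerRankThreeUp : Prop :=
  ∀ (n : ℕ) (s : Fin n → ℂ), 3 ≤ n → (∀ i, IsAlgebraic ℚ (s i)) → LinearIndependent ℚ s → ∃ a b C : ℝ, a < 1 / ((n : ℝ) - 1) ∧ 0 < C ∧ ∀ d : ℕ, ∃ H₀ : ℕ, ∀ (H : ℕ) (γ : Fin n ⊕ Fin n → ℂ), H₀ ≤ H → Module.finrank ℚ ↥(IntermediateField.adjoin ℚ (Set.range γ)) ≤ d → (∀ i, ∃ P : Polynomial ℤ, P ≠ 0 ∧ P.natDegree ≤ d ∧ (∀ k, |P.coeff k| ≤ (H : ℤ)) ∧ Polynomial.aeval (γ i) P = 0) → Real.exp (-(C * ((d : ℝ) ^ a * Real.log H + (d : ℝ) ^ b))) ≤ ‖γ - Sum.elim s (Complex.exp ∘ s)‖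

/-- LEAF 2 `NonLWLayerRankTwo` — the non-Lindemann–Weierstrass layer of the crux at rank `2`: every free
Khovanskii point `s ∈ ℂ²` with `ℚ`-linearly independent coordinates one of which is transcendental has
eventual simultaneous approximation type `a < 1` (= `EvNonLWTwo` of `…KhovanskiiApproxTypeEvDefs.lean`,
written out). -/
def NonLWLayerRankTwo : Prop :=
  ∀ s : Fin 2 → ℂ, LinearIndependent ℚ s → (∃ g : Fin 2 → MvPolynomial (Fin 2 ⊕ Fin 2) ℚ, (∀ i, MvPolynomial.aeval (Sum.elim s (Complex.exp ∘ s)) (g i) = 0) ∧ (Matrix.of fun i j => MvPolynomial.aeval (Sum.elim s (Complex.exp ∘ s)) (MvPolynomial.pderiv (Sum.inl j) (g i) + MvPolynomial.X (Sum.inr j) * MvPolynomial.pderiv (Sum.inr j) (g i))).det ≠ 0) → (∃ i, Transcendental ℚ (s i)) → ∃ a b C : ℝ, a < 1 ∧ 0 < C ∧ ∀ d : ℕ, ∃ H₀ : ℕ, ∀ (H : ℕ) (γ : Fin 2 ⊕ Fin 2 → ℂ), H₀ ≤ H → Module.finrank ℚ ↥(IntermediateField.adjoin ℚ (Set.range γ))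 ≤ d → (∀ i, ∃ P : Polynomial ℤ, P ≠ 0 ∧ P.natDegree ≤ d ∧ (∀ k, |P.coeff k| ≤ (H : ℤ)) ∧ Polynomial.aeval (γ i) P = 0) → Real.exp (-(C * ((d : ℝ) ^ a * Real.log H + (d : ℝ) ^ b))) ≤ ‖γ - Sum.elim s (Complex.exp ∘ s)‖

/-- LEAF 3 `NonLWLayerRankThreeUp` — the non-Lindemann–Weierstrass layer of the crux at rank `n ≥ 3`:
every free Khovanskii point `s ∈ ℂⁿ` (`n ≥ 3`) with `ℚ`-linearly independent coordinates one of which is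
transcendental has eventual simultaneous approximation type `a < 1/(n−1)` (= `EvNonLWRankThreeUp` of
`…RareFieldDefs.lean`, written out). -/
def NonLWLayerRankThreeUp : Prop :=
  ∀ (n : ℕ) (s : Fin n → ℂ), 3 ≤ n → LinearIndependent ℚ s → (∃ g : Fin n → MvPolynomial (Fin n ⊕ Fin n) ℚ, (∀ i, MvPolynomial.aeval (Sum.elim s (Complex.exp ∘ s)) (g i) = 0) ∧ (Matrix.of fun i j => MvPolynomial.aeval (Sum.elim s (Complex.exp ∘ s)) (MvPolynomial.pderiv (Sum.inl j) (g i) + MvPolynomial.X (Sum.inr j) * MvPolynomial.pderiv (Sum.inr j) (g i))).det ≠ 0) → (∃ i, Transcendental ℚ (s i)) → ∃ a b C : ℝ, a < 1 / ((n : ℝ) - 1) ∧ 0 < C ∧ ∀ d : ℕ, ∃ H₀ : ℕ, ∀ (H : ℕ) (γ : Fin n ⊕ Fin n → ℂ), H₀ ≤ H → Module.finrank ℚ ↥(IntermediateField.adjoin ℚ (Set.range γ)) ≤ d → (∀ i, ∃ P : Polynomial ℤ, P ≠ 0 ∧ P.natDegree ≤ d ∧ (∀ k, |P.coeff k| ≤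 (H : ℤ)) ∧ Polynomial.aeval (γ i) P = 0) → Real.exp (-(C * ((d : ℝ) ^ a * Real.log H + (d : ℝ) ^ b))) ≤ ‖γ - Sum.elim s (Complex.exp ∘ s)‖

/-! ## Dictionary with the line vocabulary (all `Iff.rfl` up to binder order) -/

/-- Leaf 1 is the naive LW layer `∀ n ≥ 3, EvLW n` of line `rare-field-species`. -/
theorem lwLayerRankThreeUp_iff : LWLayerRankThreeUp ↔ ∀ n, 3 ≤ n → EvLW n :=
  ⟨fun h n hn s halg hli => h n s hn halg hli, fun h n s hn halg hli => h n hn s halg hli⟩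

/-- Leaf 2 is `EvNonLWTwo` of line `anchored-reduction`. -/
theorem nonLWLayerRankTwo_iff : NonLWLayerRankTwo ↔ EvNonLWTwo :=
  Iff.rfl

/-- Leaf 3 is `EvNonLWRankThreeUp` of line `rare-field-species`. -/
theorem nonLWLayerRankThreeUp_iff : NonLWLayerRankThreeUp ↔ EvNonLWRankThreeUp :=
  Iff.rfl

/-! ## The glue (sorry-free) and its converse -/

/-- **GLUE OF THE SPLIT** (`--glue-by`): the three leaves give the crux BY NAME.  Honest case split on the
rank (`n = 2` or `n ≥ 3`) and on `s ∈ ℚ̄ⁿ` or not, through the unconditional three-layer equivalence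
`khovanskiiApproxTypeEv_iff_threeLayers` (p136816), which already contains the PROVED rank-2
Lindemann–Weierstrass layer (p123471). -/
theorem khovanskiiApproxTypeEv_of_subs :
    LWLayerRankThreeUp → NonLWLayerRankTwo → NonLWLayerRankThreeUp → KhovanskiiApproxTypeEv :=
  fun h₁ h₂ h₃ =>
    khovanskiiApproxTypeEv_iff_threeLayers.2
      ⟨nonLWLayerRankTwo_iff.1 h₂, lwLayerRankThreeUp_iff.1 h₁, nonLWLayerRankThreeUp_iff.1 h₃⟩

/-- The split loses nothing: the crux gives back each leaf. -/
theorem subs_of_khovanskiiApproxTypeEv (hEv : KhovanskiiApproxTypeEv) :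
    LWLayerRankThreeUp ∧ NonLWLayerRankTwo ∧ NonLWLayerRankThreeUp := by
  obtain ⟨h₂, h₁, h₃⟩ := khovanskiiApproxTypeEv_iff_threeLayers.1 hEv
  exact ⟨lwLayerRankThreeUp_iff.2 h₁, nonLWLayerRankTwo_iff.2 h₂, nonLWLayerRankThreeUp_iff.2 h₃⟩

/-- The crux is EQUIVALENT to the conjunction of its three leaves. -/
theorem khovanskiiApproxTypeEv_iff_subs :
    KhovanskiiApproxTypeEv ↔ LWLayerRankThreeUp ∧ NonLWLayerRankTwo ∧ NonLWLayerRankThreeUp :=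
  ⟨subs_of_khovanskiiApproxTypeEv, fun h => khovanskiiApproxTypeEv_of_subs h.1 h.2.1 h.2.2⟩

end Summit.Schanuel.Schanuel.Cruxes.KhovanskiiApproxTypeEv.Split

end
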